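import Summits.HodgeConjecture.HodgeConjecture.Cruxes.BlochSeedDiscOne.DiamondLevelLaws

/-!
# CeilingFork — the X⁺ forks at the ceiling: the first law-free CEILING family (`N`-side) and TWIN family (`P`-side) of the K-peel, and the typed SPAN KEY
(control g18 `plan-lens-HodgeAV-control`, crux `BlochSeedDiscOne` = H2 = item `stmt-HodgeConjecture-18881`; memo `SPAN-KEY-g18.md` next to this file)

Token: `line stmt-HodgeConjecture-18881 Cruxes/BlochSeedDiscOne/Lines/birth.lean 814a6a70c14e831a stub_rung_pad4_seedAt`.

HONEST FRAMING.  Everything here is a statement about H₁-static first-order DESIGNS (`MConfig`: `InDiamond h`, `G1Closed`, `StaticH1`) of the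
hsemireg census — research conditional in spirit on HC_CM, which enters NOWHERE (not even as a binder).  Nothing in this file proves or refutes
HC, HC_AV, HC_CM, H2 = `BlochSeedDiscOne`, (T₈), (T₁₀), `KAbsent`, `InterfaceKAbsent` or `TwinApexKAbsent`.  Designs are not sheaves and not a seed.
Imports `DiamondLevelLaws` only (other `Cruxes` modules are not built on the farm); no census inside any proof.

WHAT IS PROVED (kernel, every `h : ℤ`, no parity, no displayed law):
* §1 `xplus_unit_fork` — the X⁺ sibling clause at a ceiling apex with two children at distance ONE below the apex needs no no-twin side
  condition (`DiamondLevelLaws.xplus_two_children_gen` has a global binder `hNT`; at distance one it is vacuous).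
* §3 `descent_of_floorUnitPair` — RULE D (N) at the pair (node of a floor unit letter `ℓ_φ` at slot `b`, top of a floor unit letter `ℓ_ψ` at
  slot `c ≠ b`) has exactly one surviving alternative inside ◇_h: the descent `Z(c ↦ O) ∈ C.upper`.  `lift_of_ceilingUnit` — RULE D (P) at the pair
  (a ceiling apex `hI` at slot `a`, the node `h − 2` of a unit ceiling letter `(h−2)I + ℓ_χ` at slot `d`) forces the lift `P(d ↦ hI) ∈ C.lower`.
* §4 `ceilingForkFamily_absent` / `ceilingForkFamily_absent_static` — THE CEILING-FORK FAMILY `N{ℓ_φ, ℓ_ψ, (h−2)I+ℓ_χ, hI}` with `φ ≠ ψ` (slots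
  0,1,2,3; any slot order follows from `PermClosed C.lower`, not restated) is ABSENT from every design with `InDiamond h`, RULE D (N and P), X⁺,
  `PermClosed C.upper`, `DeltaClosed C.upper` — in particular from every `G1Closed` + `StaticH1` design.  Certificate (4 steps, = the census's
  round-1 `P:Xp` kill with EMPTY support): the two descents `P_φ = Z(0 ↦ O)`, `P_ψ = Z(1 ↦ O)` are forced; RULE D (P) at `P_φ` forces
  `X = N{O, ℓ_ψ, hI, hI}`; the Δ-rotation `Δʲ` with `Δʲ ℓ_ψ = ℓ_φ` followed by the slot swap `(0 1)` maps `P_ψ` to a SECOND unit child of `X` at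
  slot 2 in the null direction `χ+2+j ≠ χ+2` (because `φ ≠ ψ`); `xplus_unit_fork` ⇒ ⊥.  `censusRep8_absent`: the j318002 representative
  `N[l-1|li|6I+l-1|8I]` (◇₈ peel table sha16 a459e02921a60310, round 1, kind P:Xp, nprop 4) is an instance; the ◇₁₀ representative
  `N[l-1|li|8I+l-1|10I]` (74004db439790926, round 1, P:Xp) is the `h = 10` instance of the same theorem.  The `φ = ψ` cells are NOT covered
  (census: round 3 at ◇₈, round 4 at ◇₁₀, nprop 231–1123 — not law-free) and the theorem's hypothesis `φ ≠ ψ` is where they fail (one child only).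
* §6 THE SPAN KEY, typed: `span Z = max causal top − min node`, a tie-break `μ : MCell → ℤ` (the experiment uses `totalCharge`), `Precedes μ`,
  the span steps `SpanStepN h μ BadN BadP Z` / `SpanStepP …` («`Z` is absent from every G₁-closed H₁-static ◇_h-design from which every bad cell
  of larger span, or equal span and smaller μ, is absent») and the assembly `badFamily_absent_of_spanSteps` (extremal counterexample: maximal span,
  then minimal μ).  `spanStepN_ceilingForkFamily`: the ceiling-fork family has its span step with an EMPTY induction hypothesis, for every μ and
  every bad family; `span_ceilingForkFamily`: its cells are full-span (`span = h`).
* §7 `twinForkFamily_absent` / `_static` / `_origin` — THE TWIN-FORK FAMILY `P{x, 2I + m·ℓ_u, hI, w}` (`h = 2m+4`, `m ≥ 1`; `x = c·ℓ_φ` a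
  floor-node letter, `c ≥ 0`, `c = 0` the origin; the fourth letter `w` ARBITRARY) is ABSENT from every design with `InDiamond h`, RULE D (N and P)
  and X⁺ — no G₁ symmetry at all.  Certificate (3 steps = the census's round-1 `P:Xp` kill, 3 propagations): RULE D (P) at the pair (top `h−2` of
  `2I+mℓ_u`, apex) forces the LIFT `N = P(1 ↦ 2I+(m+1)ℓ_u)` (`twin_lift`, via `upLine_of_ruleDMu4P`; distance one by the diamond); RULE D (N) at the
  pair (node `0` of `x`, node `2` of the ceiling letter `2I+(m+1)ℓ_u`) forces the DESCENT `P' = N(1 ↦ (m+2)ℓ_u)` (`twin_descent`: nothing serves or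
  covers a floor-node letter from below off its own ray; below the ceiling letter off its ray sits only the full letter); the X⁺ fork at `N 1` with
  the two distance-one children `P` (direction `u`) and `P'` (direction `u+2`) is contradictory (`xplus_fork`; (H-e′) by `ceiling_effective_sameRay`
  + `fork_effective`).  Census (cited, not used): ALL 604 orbits of ◇₈ `P`-cells ⊇ {node-0 letter, 2I+2ℓ_u, 8I} and ALL 1145 orbits of ◇₁₀ `P`-cells
  ⊇ {node-0 letter, 2I+3ℓ_u, 10I} are peel round 1 (j318002 tables a459e02921a60310 / 74004db439790926; 598 + 1142 `P:Xp`, 6 + 3 `P:DN`);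
  `censusTwin8_absent` (`P[l-1|2I+2l-1|8I|8I]`) and `censusTwin8o_absent` (`P[O|O|2I+2l-1|8I]`, var 442, nprop 3) are instances.
  `spanStepP_twinForkFamily`: its span step has an EMPTY induction hypothesis (every μ, every bad family).
WHAT IS NOT PROVED: any span step for the other interface ∕ twin-apex K-shapes (the memo's E4 tables say which shapes have a ONE-CLAUSE span step
under μ = total charge in the census-free probe, and which do not — the twin-apex heads, whose forced alternatives are apex-children); hence
neither `InterfaceKAbsent` nor `TwinApexKAbsent` nor `KAbsent` at any `h`.
-/

set_option linter.dupNamespace false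
set_option linter.unusedSimpArgs false

namespace Summit.HodgeConjecture.HodgeConjecture.Cruxes.BlochSeedDiscOne.CeilingFork

open Finset Summit.Ventures.HSemireg.Pad4Tower
open Summit.HodgeConjecture.HodgeConjecture.Cruxes.BlochSeedDiscOne.DiamondLevelLaws

/-! ## §1 The X⁺ fork at a ceiling apex with two UNIT children needs no side condition -/

/-- **THE UNIT FORK** (KERNEL, every `h`, law-free): an `N`-cell `Z` with two ceiling apices `Z g = Z f = hI` cannot have two `P`-children
`P₁ = Z(g ↦ y₁)`, `P₂ = Z(g ↦ y₂)` at DISTANCE ONE below the apex (`α(yᵢ) = h − 1`) in two different null directions.  This is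
`xplus_two_children_gen` with its no-twin side condition `hNT` DISCHARGED: both uses of `hNT` concern `N`-twins strictly between a child and the
apex, and there is no lattice level strictly between `h − 1` and `h`. -/
theorem xplus_unit_fork {h : ℤ} {C : MConfig} (hU : C.InDiamond h) (hX : XPlusClosed C) {Z : MCell} (hZ : Z ∈ C.lower)
    {g f : Fin 4} (hfg : f ≠ g) (hg : Z g = (h, 0, 0)) (hf : Z f = (h, 0, 0)) {P₁ P₂ : MCell}
    (hP₁ : P₁ ∈ C.upper) (hP₂ : P₂ ∈ C.upper) {r₁ r₂ : Fin 4} (hr : r₂ ≠ r₁) (h1 : UPartner Z P₁ g r₁) (h2 : UPartner Z P₂ g r₂)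
    (hd₁ : (P₁ g).1 = h - 1) (hd₂ : (P₂ g).1 = h - 1) : False := by
  have hZg1 : (Z g).1 = h := by rw [hg]
  have h1ray : ((h, 0, 0) : BPoint) = ray (P₁ g) r₁ (h - (P₁ g).1) := by have := h1.2.2; rw [hg] at this; exact this
  refine hX (dualCell 0 P₁) (dualCell_mem_dual_lower hP₁) (dualCell 0 Z) (dualCell_mem_dual_upper hZ) (dualCell 0 P₂)
    (dualCell_mem_dual_lower hP₂) g r₁ r₂ f ⟨?_, hfg, (uPartner_dual 0 Z P₁ g r₁).mpr h1, ?_, hr, ?_, ?_, ?_, ?_, ?_⟩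
  · -- `(P₁ g)^∨` is charged: `P₁ g` is a child of the apex `hI`
    exact fun hap => not_isApex_below_apex (by omega) h1ray ((isApex_dual 0 (P₁ g)).mp hap)
  · -- topmost partner: an `N`-twin strictly between `P₁ g` and `hI` would live at a level strictly between `h − 1` and `h`
    intro P hP hPu
    obtain ⟨X, hXl, rfl⟩ := Finset.mem_image.mp hP
    have hu : UPartner X P₁ g r₁ := (uPartner_dual 0 X P₁ g r₁).mp hPu
    show 0 - (X g).1 ≤ 0 - (Z g).1
    have hlt : (P₁ g).1 < (X g).1 := hu.2.1
    have hle : (X g).1 ≤ h := fst_le_of_inDiamond (hU.1 X hXl g)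
    omega
  · -- `P₂^∨` is an `r₂`-sibling of `Z^∨`
    exact ⟨magree_dual.mpr (fun j hj => (h2.1 j hj).symm), (ray_dual_iff 0 (Z g) (P₂ g) r₂).mpr ⟨h2.2.1, h2.2.2⟩⟩
  · -- no companion: a companion strictly between `P₂ g` and `hI` would live at a level strictly between `h − 1` and `h`
    intro P hP _ hlt1 hlt2 _
    obtain ⟨X, hXl, rfl⟩ := Finset.mem_image.mp hP
    exfalso
    change 0 - (Z g).1 < 0 - (X g).1 at hlt1
    change 0 - (X g).1 < 0 - (P₂ g).1 at hlt2
    have hle : (X g).1 ≤ h := fst_le_of_inDiamond (hU.1 X hXl g)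
    omega
  · -- `HeOkP⁺`: every letter of ◇_h lies causally below `hI`
    intro P hP _ _ _ _
    obtain ⟨X, hXl, rfl⟩ := Finset.mem_image.mp hP
    show Effective (bsub (dualPt 0 (X g)) (dualPt 0 (Z g)))
    rw [bsub_dualPt0, hg]
    exact effective_ceilingApex_sub (hU.1 X hXl g)
  · -- `HbOkP⁺`: vacuous
    intro P hP _ hnb _
    obtain ⟨X, hXl, rfl⟩ := Finset.mem_image.mp hP
    exfalso
    have e1 : (P₁ f).1 = h := by rw [(h1.1 f hfg).trans hf]
    have := hnb.1
    change 0 - (X f).1 < 0 - (P₁ f).1 at this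
    have hle := fst_le_of_inDiamond (hU.1 X hXl f)
    omega
  · -- `WfEmpty⁺`: vacuous
    intro P hP hnb
    obtain ⟨X, hXl, rfl⟩ := Finset.mem_image.mp hP
    exfalso
    have e1 : (P₁ f).1 = h := by rw [(h1.1 f hfg).trans hf]
    have := hnb.1
    change 0 - (X f).1 < 0 - (P₁ f).1 at this
    have hle := fst_le_of_inDiamond (hU.1 X hXl f)
    omega

/-! ## §2 Letter geometry of the unit floor letters `ℓ_φ` and the unit ceiling letters `(h−2)I + ℓ_χ` -/

/-- the unit floor letter `ℓ_φ = O + n_φ` (`α = c = 1`, node `0`, causal top `2`). -/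
abbrev floorUnit (φ : Fin 4) : BPoint := ray ((0, 0, 0) : BPoint) φ 1

/-- the unit ceiling letter `(h−2)I + ℓ_χ` (`α = h − 1`, `c = 1`, node `h − 2`, causal top `h`). -/
abbrev ceilingUnit (h : ℤ) (χ : Fin 4) : BPoint := ray ((h - 2, 0, 0) : BPoint) χ 1

theorem floorUnit_not_isApex (φ : Fin 4) : ¬ isApex (floorUnit φ) := by
  fin_cases φ <;> simp [ray, isApex]

theorem floorUnit_fst (φ : Fin 4) : (floorUnit φ).1 = 1 := by
  fin_cases φ <;> simp [ray]

/-- the NODE direction of `ℓ_φ` is `φ + 2`, with coordinate `0` … -/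
theorem floorUnit_node (φ : Fin 4) : Adapted (floorUnit φ) (φ + 2) ∧ coord (floorUnit φ) (φ + 2) = 0 := by
  fin_cases φ <;> simp [ray, coord, Adapted]

/-- … and its TOP direction is `φ`, with coordinate `2`. -/
theorem floorUnit_top (φ : Fin 4) : Adapted (floorUnit φ) φ ∧ coord (floorUnit φ) φ = 2 := by
  fin_cases φ <;> simp [ray, coord, Adapted]

theorem ceilingUnit_not_isApex (h : ℤ) (χ : Fin 4) : ¬ isApex (ceilingUnit h χ) := by
  fin_cases χ <;> simp [ray, isApex]

theorem ceilingUnit_fst (h : ℤ) (χ : Fin 4) : (ceilingUnit h χ).1 = h - 1 := by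
  fin_cases χ <;> simp [ray] <;> omega

/-- the NODE direction of `(h−2)I + ℓ_χ` is `χ + 2`, with coordinate `h − 2`. -/
theorem ceilingUnit_node (h : ℤ) (χ : Fin 4) : Adapted (ceilingUnit h χ) (χ + 2) ∧ coord (ceilingUnit h χ) (χ + 2) = h - 2 := by
  fin_cases χ <;> simp [ray, coord, Adapted]

/-- one step up the node direction from `(h−2)I + ℓ_χ` is the ceiling apex `hI`. -/
theorem ceilingApex_eq_ray_ceilingUnit (h : ℤ) (χ : Fin 4) : ((h, 0, 0) : BPoint) = ray (ceilingUnit h χ) (χ + 2) 1 := by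
  fin_cases χ <;> simp [ray] <;> omega

/-- **BELOW A UNIT FLOOR LETTER THERE IS ONLY `O`, ALONG THE LETTER'S OWN RAY** (KERNEL): a μ₄ point `y` with `c ≤ α` strictly null-below
`ℓ_φ` in direction `r` is `O`, and `r = φ`. -/
theorem below_floorUnit {h : ℤ} {y : BPoint} (hy : InDiamond h y) {φ r : Fin 4} {d : ℤ} (hd : 0 < d)
    (he : floorUnit φ = ray y r d) : r = φ ∧ y = (0, 0, 0) := by
  obtain ⟨α, a, b⟩ := y
  obtain ⟨hax, h1, -, -⟩ := hy
  simp only [AxisPt, absCharge, chargeOf, ray, Prod.mk.injEq] at hax h1 he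
  fin_cases φ <;> fin_cases r <;> simp at he hax ⊢ <;>
    (simp only [abs_eq_max_neg, max_def] at h1; split_ifs at h1 <;> omega)

/-- **ABOVE A UNIT CEILING LETTER THERE IS ONLY `hI`, ALONG THE NODE DIRECTION** (KERNEL): a point of ◇_h strictly null-above `(h−2)I + ℓ_χ`
in direction `r` is the apex `hI`, and `r = χ + 2`. -/
theorem above_ceilingUnit {h : ℤ} {y : BPoint} (hy : InDiamond h y) {χ r : Fin 4} {e : ℤ} (he0 : 0 < e)
    (he : y = ray (ceilingUnit h χ) r e) : r = χ + 2 ∧ y = (h, 0, 0) := by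
  subst he
  obtain ⟨hax, h1, -, h3⟩ := hy
  simp only [AxisPt, absCharge, chargeOf, ray, Prod.mk.injEq] at hax h1 h3 ⊢
  fin_cases χ <;> fin_cases r <;> simp at hax h1 h3 ⊢ <;>
    (simp only [abs_eq_max_neg, max_def] at h1 h3; split_ifs at h1 h3 <;> omega)

/-- `Δ` rotates the unit letters: `Δ ℓ_φ = ℓ_{φ+3}`, `Δ((h−2)I + ℓ_χ) = (h−2)I + ℓ_{χ+3}`, `Δ` fixes apices. -/
theorem deltaPt_floorUnit (φ : Fin 4) : deltaPt (floorUnit φ) = floorUnit (φ + 3) := by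
  fin_cases φ <;> simp [ray, deltaPt]

theorem deltaPt_ceilingUnit (h : ℤ) (χ : Fin 4) : deltaPt (ceilingUnit h χ) = ceilingUnit h (χ + 3) := by
  fin_cases χ <;> simp [ray, deltaPt]

theorem deltaPt_apex (a : ℤ) : deltaPt ((a, 0, 0) : BPoint) = (a, 0, 0) := by
  simp [deltaPt]

theorem floorUnit_inj {φ ψ : Fin 4} (e : floorUnit φ = floorUnit ψ) : φ = ψ :=
  ray_apex_dir_inj one_ne_zero e

theorem fin4_add3_ne (χ : Fin 4) : χ + 3 ≠ χ := by fin_cases χ <;> decide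
theorem fin4_add33_ne (χ : Fin 4) : χ + 3 + 3 ≠ χ := by fin_cases χ <;> decide
theorem fin4_add333_ne (χ : Fin 4) : χ + 3 + 3 + 3 ≠ χ := by fin_cases χ <;> decide

/-! ## §3 The forcing steps: a unit floor pair forces the two descents, a unit ceiling letter forces the lift -/

/-- **DESCENT** (KERNEL, every `h`; RULE D at the `N`-cell): an `N`-cell `Z` of a RULE-D-closed design in ◇_h with two unit floor letters
`Z b = ℓ_φ`, `Z c = ℓ_ψ` on different slots has the `P`-child `Z(c ↦ O)` present.  (The pair of coordinates «node of `ℓ_φ`» `= 0` and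
«top of `ℓ_ψ`» `= 2` is unequal; the node coordinate of a floor letter can be neither settled nor covered below; so the top coordinate of `ℓ_ψ`
is settled below, i.e. `ℓ_ψ` is served by `O`.) -/
theorem descent_of_floorUnitPair {h : ℤ} {C : MConfig} (hU : C.InDiamond h) {Z : MCell} (hD : RuleDMu4N C Z)
    {b c : Fin 4} (hbc : b ≠ c) {φ ψ : Fin 4} (hb : Z b = floorUnit φ) (hc : Z c = floorUnit ψ) :
    ∃ P ∈ C.upper, MAgree P Z c ∧ P c = (0, 0, 0) := by
  have hk : Adapted (Z b) (φ + 2) := by rw [hb]; exact (floorUnit_node φ).1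
  have hk0 : coord (Z b) (φ + 2) = 0 := by rw [hb]; exact (floorUnit_node φ).2
  have hk' : Adapted (Z c) ψ := by rw [hc]; exact (floorUnit_top ψ).1
  have hk'2 : coord (Z c) ψ = 2 := by rw [hc]; exact (floorUnit_top ψ).2
  have hne : coord (Z b) (φ + 2) ≠ coord (Z c) ψ := by rw [hk0, hk'2]; decide
  -- no service below `ℓ_φ` except by `O` in direction `φ`
  have nob : ∀ P ∈ C.upper, ∀ r : Fin 4, UPartner Z P b r → r = φ ∧ P b = (0, 0, 0) := fun P hP r hZP => by
    have hd : 0 < (Z b).1 - (P b).1 := by have := hZP.2.1; omega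
    have e : floorUnit φ = ray (P b) r ((Z b).1 - (P b).1) := by rw [← hb]; exact hZP.2.2
    exact below_floorUnit (hU.2 P hP b) hd e
  rcases hD b c hbc (φ + 2) ψ hk hk' hne with ⟨r, hr, P, hP, hZP⟩ | ⟨r, hr, P, hP, hZP⟩ | ⟨a, a', ha, -, P, hP, -, hb1, hb2, -, -⟩
  · -- `(b, φ+2)` settled below: service in a direction `r ≠ φ` — impossible
    exact absurd ((nob P hP r hZP).1.trans (fin4_add_two_add_two φ).symm) hr
  · -- `(c, ψ)` settled below: the server is `Z(c ↦ O)`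
    have hd : 0 < (Z c).1 - (P c).1 := by have := hZP.2.1; omega
    have e : floorUnit ψ = ray (P c) r ((Z c).1 - (P c).1) := by rw [← hc]; exact hZP.2.2
    exact ⟨P, hP, hZP.1, (below_floorUnit (hU.2 P hP c) hd e).2⟩
  · -- covered below: the cover moves `ℓ_φ` down in its node direction `φ + 2` — impossible
    have ha' : a = φ + 2 := by
      rcases ha with e | ⟨hap, _⟩
      · exact e
      · exact absurd hap (by rw [hb]; exact floorUnit_not_isApex φ)
    have hd : 0 < (Z b).1 - (P b).1 := by omega
    have e : floorUnit φ = ray (P b) a ((Z b).1 - (P b).1) := by rw [← hb]; exact hb2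
    have := (below_floorUnit (hU.2 P hP b) hd e).1
    rw [ha'] at this
    exact absurd (this.trans (fin4_add_two_add_two φ).symm) (by
      intro h4; have := congrArg (· + 2) h4; simp at this)

/-- **LIFT** (KERNEL, every `h`; RULE D at the `P`-cell = `upLine_of_ruleDMu4P` + `above_ceilingUnit`): a `P`-cell `P` of a RULE-D-closed design
in ◇_h with a ceiling letter on slot `a` and the unit ceiling letter `(h−2)I + ℓ_χ` on slot `d ≠ a` has the `N`-parent `P(d ↦ hI)` present, as a
`(χ+2)`-partner. -/
theorem lift_of_ceilingUnit {h : ℤ} {C : MConfig} (hU : C.InDiamond h) {P : MCell} (hP : P ∈ C.upper) (hD : RuleDMu4P C P)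
    {a d : Fin 4} (had : a ≠ d) (hac : OnCeiling h (P a)) {χ : Fin 4} (hd : P d = ceilingUnit h χ) :
    ∃ N ∈ C.lower, UPartner N P d (χ + 2) ∧ N d = (h, 0, 0) := by
  have hna : ¬ isApex (P d) := by rw [hd]; exact ceilingUnit_not_isApex h χ
  have hk : Adapted (P d) (χ + 2) := by rw [hd]; exact (ceilingUnit_node h χ).1
  have hkh : coord (P d) (χ + 2) ≠ h := by rw [hd, (ceilingUnit_node h χ).2]; omega
  obtain ⟨N, hN, hNP⟩ := upLine_of_ruleDMu4P hU hP hD had hac hna hk hkh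
  have he0 : 0 < (N d).1 - (P d).1 := by have := hNP.2.1; omega
  have e : N d = ray (ceilingUnit h χ) (χ + 2) ((N d).1 - (P d).1) := by rw [← hd]; exact hNP.2.2
  exact ⟨N, hN, hNP, (above_ceilingUnit (hU.1 N hN d) he0 e).2⟩

/-! ## §4 THE CEILING-FORK FAMILY IS ABSENT (law-free, every `h`) -/

/-- **THE FORK CORE** (KERNEL, every `h`): if the `N`-cell `X = N{O, ℓ_ψ, hI, hI}` (slots `0, 1, 2, 3`) is present together with two `P`-children
`X(2 ↦ (h−2)I + ℓ_χ)`, `X(2 ↦ (h−2)I + ℓ_χ')` with `χ ≠ χ'`, the X⁺ law is violated (`xplus_unit_fork`). -/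
theorem fork_core {h : ℤ} {C : MConfig} (hU : C.InDiamond h) (hX : XPlusClosed C) {X : MCell} (hXl : X ∈ C.lower)
    (hX2 : X 2 = (h, 0, 0)) (hX3 : X 3 = (h, 0, 0)) {P₁ P₂ : MCell} (hP₁ : P₁ ∈ C.upper) (hP₂ : P₂ ∈ C.upper)
    {χ χ' : Fin 4} (hχ : χ' ≠ χ) (h1 : MAgree P₁ X 2) (hP₁2 : P₁ 2 = ceilingUnit h χ) (h2 : MAgree P₂ X 2) (hP₂2 : P₂ 2 = ceilingUnit h χ') :
    False := by
  have u1 : UPartner X P₁ 2 (χ + 2) := by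
    refine ⟨h1, by rw [hP₁2, hX2, ceilingUnit_fst]; omega, ?_⟩
    rw [hX2, hP₁2, ceilingUnit_fst, show h - (h - 1) = 1 by ring]
    exact ceilingApex_eq_ray_ceilingUnit h χ
  have u2 : UPartner X P₂ 2 (χ' + 2) := by
    refine ⟨h2, by rw [hP₂2, hX2, ceilingUnit_fst]; omega, ?_⟩
    rw [hX2, hP₂2, ceilingUnit_fst, show h - (h - 1) = 1 by ring]
    exact ceilingApex_eq_ray_ceilingUnit h χ'
  have hr : χ' + 2 ≠ χ + 2 := fun e => hχ (add_right_cancel e)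
  exact xplus_unit_fork hU hX hXl (g := 2) (f := 3) (by decide) hX2 hX3 hP₁ hP₂ hr u1 u2
    (by rw [hP₁2, ceilingUnit_fst]) (by rw [hP₂2, ceilingUnit_fst])

/-- **THE CEILING-FORK FAMILY** `N{ℓ_φ, ℓ_ψ, (h−2)I + ℓ_χ, hI}` with `φ ≠ ψ` (slots `0, 1, 2, 3`; the census orbits `N[l-1|li|6I+l_χ|8I]`,
`N[l-1|l1|6I+l_χ|8I]` of ◇₈ and `N[l-1|li|8I+l_χ|10I]`, … of ◇₁₀, all peel round 1, kind `P:Xp`, 4–5 propagations) **IS ABSENT from every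
two-level design in ◇_h obeying RULE D and the X⁺ law whose `P`-level is `S₄`- and `Δ`-symmetric** (KERNEL, every `h`, law-free: no (CD),
(LVN), (LVP), (DL3); the A2I⁻ law is not used). -/
theorem ceilingForkFamily_absent {h : ℤ} {C : MConfig} (hU : C.InDiamond h) (hDN : ∀ Z ∈ C.lower, RuleDMu4N C Z)
    (hDP : ∀ P ∈ C.upper, RuleDMu4P C P) (hX : XPlusClosed C) (hGu : PermClosed C.upper) (hΔu : DeltaClosed C.upper)
    {Z : MCell} {φ ψ χ : Fin 4} (hφψ : φ ≠ ψ) (h0 : Z 0 = floorUnit φ) (h1 : Z 1 = floorUnit ψ) (h2 : Z 2 = ceilingUnit h χ)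
    (h3 : Z 3 = (h, 0, 0)) : Z ∉ C.lower := fun hZ => by
  -- the two descents `P_x = Z(0 ↦ O)`, `P_y = Z(1 ↦ O)`
  obtain ⟨Px, hPx, hPxZ, hPx0⟩ := descent_of_floorUnitPair hU (hDN Z hZ) (b := 1) (c := 0) (by decide) h1 h0
  obtain ⟨Py, hPy, hPyZ, hPy1⟩ := descent_of_floorUnitPair hU (hDN Z hZ) (b := 0) (c := 1) (by decide) h0 h1
  have hPx1 : Px 1 = floorUnit ψ := (hPxZ 1 (by decide)).trans h1
  have hPx2 : Px 2 = ceilingUnit h χ := (hPxZ 2 (by decide)).trans h2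
  have hPx3 : Px 3 = (h, 0, 0) := (hPxZ 3 (by decide)).trans h3
  have hPy0 : Py 0 = floorUnit φ := (hPyZ 0 (by decide)).trans h0
  have hPy2 : Py 2 = ceilingUnit h χ := (hPyZ 2 (by decide)).trans h2
  have hPy3 : Py 3 = (h, 0, 0) := (hPyZ 3 (by decide)).trans h3
  -- the lift `X = P_x(2 ↦ hI) = N{O, ℓ_ψ, hI, hI}`
  obtain ⟨X, hXl, hXP, hXd⟩ := lift_of_ceilingUnit hU hPx (hDP Px hPx) (a := 3) (d := 2) (by decide)
    (by rw [hPx3]; exact onCeiling_apex h) hPx2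
  have hX0 : X 0 = (0, 0, 0) := (hXP.1 0 (by decide)).symm.trans hPx0
  have hX1 : X 1 = floorUnit ψ := (hXP.1 1 (by decide)).symm.trans hPx1
  have hX3 : X 3 = (h, 0, 0) := (hXP.1 3 (by decide)).symm.trans hPx3
  -- the second child: rotate `P_y` by the power of `Δ` taking `ℓ_φ` to `ℓ_ψ`, then swap the slots `0, 1`
  have child : ∀ Q ∈ C.upper, Q 0 = floorUnit ψ → Q 1 = (0, 0, 0) → (∃ χ', χ' ≠ χ ∧ Q 2 = ceilingUnit h χ') → Q 3 = (h, 0, 0) → False :=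
    fun Q hQ hQ0 hQ1 ⟨χ', hχ', hQ2⟩ hQ3 => by
      have hQ' := hGu (Equiv.swap 0 1) Q hQ
      refine fork_core hU hX hXl hXd hX3 hPx hQ' hχ' hXP.1 hPx2 (fun g hg => ?_) ?_
      · show Q (Equiv.swap (0 : Fin 4) 1 g) = X g
        fin_cases g
        · simpa using hQ1.trans hX0.symm
        · simpa using hQ0.trans hX1.symm
        · exact absurd rfl hg
        · simpa [Equiv.swap_apply_of_ne_of_ne] using hQ3.trans hX3.symm
      · show Q (Equiv.swap (0 : Fin 4) 1 2) = ceilingUnit h χ'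
        simpa [Equiv.swap_apply_of_ne_of_ne] using hQ2
  have d1 : ∀ Q : MCell, ∀ f, Q.delta f = deltaPt (Q f) := fun Q f => rfl
  rcases deltaPt_align 0 1 ψ φ with e | e | e | e
  · exact hφψ (floorUnit_inj e).symm
  · refine child Py.delta (hΔu Py hPy) ?_ ?_ ⟨χ + 3, fin4_add3_ne χ, ?_⟩ ?_
    · rw [d1, hPy0]; exact e.symm
    · rw [d1, hPy1, deltaPt_apex]
    · rw [d1, hPy2, deltaPt_ceilingUnit]
    · rw [d1, hPy3, deltaPt_apex]
  · refine child Py.delta.delta (hΔu _ (hΔu Py hPy)) ?_ ?_ ⟨χ + 3 + 3, fin4_add33_ne χ, ?_⟩ ?_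
    · rw [d1, d1, hPy0]; exact e.symm
    · rw [d1, d1, hPy1, deltaPt_apex, deltaPt_apex]
    · rw [d1, d1, hPy2, deltaPt_ceilingUnit, deltaPt_ceilingUnit]
    · rw [d1, d1, hPy3, deltaPt_apex, deltaPt_apex]
  · refine child Py.delta.delta.delta (hΔu _ (hΔu _ (hΔu Py hPy))) ?_ ?_ ⟨χ + 3 + 3 + 3, fin4_add333_ne χ, ?_⟩ ?_
    · rw [d1, d1, d1, hPy0]; exact e.symm
    · rw [d1, d1, d1, hPy1, deltaPt_apex, deltaPt_apex, deltaPt_apex]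
    · rw [d1, d1, d1, hPy2, deltaPt_ceilingUnit, deltaPt_ceilingUnit, deltaPt_ceilingUnit]
    · rw [d1, d1, d1, hPy3, deltaPt_apex, deltaPt_apex, deltaPt_apex]

/-- **PACKAGED over the typed static predicates of record** (`StaticH1 = RuleDMu4Closed ∧ XPlusClosed ∧ A2IMinusClosed`, `G1Closed`):
in every two-level design in ◇_h that is `G₁`-closed and `H₁`-static, the ceiling-fork family is absent — for EVERY `h` (no parity, no
`h ≤ 10`, no level law). -/
theorem ceilingForkFamily_absent_static {h : ℤ} {C : MConfig} (hU : C.InDiamond h) (hG : C.G1Closed) (hS : C.StaticH1)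
    {Z : MCell} {φ ψ χ : Fin 4} (hφψ : φ ≠ ψ) (h0 : Z 0 = floorUnit φ) (h1 : Z 1 = floorUnit ψ) (h2 : Z 2 = ceilingUnit h χ)
    (h3 : Z 3 = (h, 0, 0)) : Z ∉ C.lower :=
  ceilingForkFamily_absent hU hS.1.1 hS.1.2 hS.2.1 hG.2.1 hG.2.2.2 hφψ h0 h1 h2 h3

/-! ## §5 Sanity: the census representatives are instances (h = 8: `N[l-1|li|6I+l-1|8I]`; h = 10: `N[l-1|li|8I+l-1|10I]`) -/

/-- the ◇₈ census orbit representative `N[l-1|li|6I+l-1|8I]` (j318002 var 11889, peel round 1, `P:Xp`, 4 propagations), written with the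
encoder's letter coordinates `ℓ_{-1} = (1,−1,0)`, `ℓ_i = (1,0,−1)`, `6I+ℓ_{-1} = (7,−1,0)`, `8I = (8,0,0)`. -/
def censusRep8 : MCell := ![((1, -1, 0) : BPoint), (1, 0, -1), (7, -1, 0), (8, 0, 0)]

theorem censusRep8_spec : censusRep8 0 = floorUnit 2 ∧ censusRep8 1 = floorUnit 1 ∧ censusRep8 2 = ceilingUnit 8 2 ∧
    censusRep8 3 = (8, 0, 0) := by
  refine ⟨?_, ?_, ?_, ?_⟩ <;> simp [censusRep8, ray]

/-- hence absent from every `G₁`-closed `H₁`-static design in ◇₈ (an instance of the `h`-uniform theorem, not a census fact). -/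
theorem censusRep8_absent {C : MConfig} (hU : C.InDiamond 8) (hG : C.G1Closed) (hS : C.StaticH1) : censusRep8 ∉ C.lower :=
  ceilingForkFamily_absent_static hU hG hS (φ := 2) (ψ := 1) (χ := 2) (by decide) censusRep8_spec.1 censusRep8_spec.2.1
    censusRep8_spec.2.2.1 censusRep8_spec.2.2.2

/-! ## §6 THE SPAN KEY (typed): absence of a bad family by induction DESCENDING in the span, ASCENDING in the total charge -/

/-- the causal extent of a cell: its highest causal top `max_f (α_f + c_f)`. -/
def cellTop (Z : MCell) : ℤ := max (max (causalTop (Z 0)) (causalTop (Z 1))) (max (causalTop (Z 2)) (causalTop (Z 3)))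

/-- … and its lowest node `min_f (α_f − c_f)`. -/
def cellNode (Z : MCell) : ℤ := min (min (nodeLevel (Z 0)) (nodeLevel (Z 1))) (min (nodeLevel (Z 2)) (nodeLevel (Z 3)))

/-- **THE SPAN** of a cell `= max causal top − min node` (`= h − (floor distance + ceiling distance)`; a full-span cell of ◇_h touches both
boundary lines).  The census key of this memo: the `K`-peel of j318002 proceeds by DESCENDING span. -/
def span (Z : MCell) : ℤ := cellTop Z - cellNode Z

/-- total charge `Q = Σ_f c_f` (the tie-break of the census experiment E4-B inside a span class: ascending). -/
def totalCharge (Z : MCell) : ℤ := absCharge (Z 0) + absCharge (Z 1) + absCharge (Z 2) + absCharge (Z 3)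

/-- `Z'` PRECEDES `Z` in the kill order with tie-break `μ`: larger span, or equal span and smaller `μ`. -/
def Precedes (μ : MCell → ℤ) (Z' Z : MCell) : Prop := span Z < span Z' ∨ (span Z' = span Z ∧ μ Z' < μ Z)

/-- **THE SPAN STEP at an `N`-cell `Z`** for a two-level bad family `(BadN, BadP)` and a tie-break `μ`: `Z` is absent from every `G₁`-closed
`H₁`-static design in ◇_h from which every bad cell PRECEDING `Z` is absent.  (The induction hypothesis knows only the span and `μ` of cells.) -/
def SpanStepN (h : ℤ) (μ : MCell → ℤ) (BadN BadP : MCell → Prop) (Z : MCell) : Prop :=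
  ∀ C : MConfig, C.InDiamond h → C.G1Closed → C.StaticH1 →
    (∀ Z' ∈ C.lower, BadN Z' → ¬ Precedes μ Z' Z) → (∀ P' ∈ C.upper, BadP P' → ¬ Precedes μ P' Z) → Z ∉ C.lower

/-- **THE SPAN STEP at a `P`-cell `P`**. -/
def SpanStepP (h : ℤ) (μ : MCell → ℤ) (BadN BadP : MCell → Prop) (P : MCell) : Prop :=
  ∀ C : MConfig, C.InDiamond h → C.G1Closed → C.StaticH1 →
    (∀ Z' ∈ C.lower, BadN Z' → ¬ Precedes μ Z' P) → (∀ P' ∈ C.upper, BadP P' → ¬ Precedes μ P' P) → P ∉ C.upper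

/-- **SPAN INDUCTION** (KERNEL, every `h`, every bad family, every tie-break): if every bad cell has its span step, the bad family is absent
from every `G₁`-closed `H₁`-static design in ◇_h.  (Proof: a present bad cell of maximal span and, among those, minimal `μ` has no present
bad predecessor.) -/
theorem badFamily_absent_of_spanSteps {h : ℤ} {μ : MCell → ℤ} {BadN BadP : MCell → Prop}
    (hN : ∀ Z, BadN Z → SpanStepN h μ BadN BadP Z) (hP : ∀ P, BadP P → SpanStepP h μ BadN BadP P)
    {C : MConfig} (hU : C.InDiamond h) (hG : C.G1Closed) (hS : C.StaticH1) :
    (∀ Z ∈ C.lower, ¬ BadN Z) ∧ (∀ P ∈ C.upper, ¬ BadP P) := by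
  classical
  -- the present bad cells, tagged by level
  let B : Finset (Bool × MCell) :=
    ((C.lower.filter fun Z => BadN Z).image fun Z => (false, Z)) ∪ ((C.upper.filter fun P => BadP P).image fun P => (true, P))
  have memB : ∀ x : Bool × MCell, x ∈ B ↔ (x.1 = false ∧ x.2 ∈ C.lower ∧ BadN x.2) ∨ (x.1 = true ∧ x.2 ∈ C.upper ∧ BadP x.2) := by
    rintro ⟨b, X⟩
    simp only [B, Finset.mem_union, Finset.mem_image, Finset.mem_filter, Prod.mk.injEq]
    constructor
    · rintro (⟨Y, ⟨hY, hb⟩, hbY, rfl⟩ | ⟨Y, ⟨hY, hb⟩, hbY, rfl⟩)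
      · exact Or.inl ⟨hbY.symm, hY, hb⟩
      · exact Or.inr ⟨hbY.symm, hY, hb⟩
    · rintro (⟨rfl, hX, hb⟩ | ⟨rfl, hX, hb⟩)
      · exact Or.inl ⟨X, ⟨hX, hb⟩, rfl, rfl⟩
      · exact Or.inr ⟨X, ⟨hX, hb⟩, rfl, rfl⟩
  by_cases hB : B.Nonempty
  · exfalso
    -- maximal span …
    obtain ⟨x₁, hx₁, hmax⟩ := B.exists_max_image (fun x => span x.2) hB
    -- … and among the cells of that span, minimal `μ`
    obtain ⟨x, hx, hmin⟩ := (B.filter fun y => span y.2 = span x₁.2).exists_min_image (fun y => μ y.2)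
      ⟨x₁, Finset.mem_filter.2 ⟨hx₁, rfl⟩⟩
    obtain ⟨hxB, hxs⟩ := Finset.mem_filter.1 hx
    have nopred : ∀ y ∈ B, ¬ Precedes μ y.2 x.2 := fun y hy hp => by
      rcases hp with hlt | ⟨heq, hq⟩
      · have := hmax y hy; rw [hxs] at hlt; omega
      · have := hmin y (Finset.mem_filter.2 ⟨hy, heq.trans hxs⟩); omega
    have hNo : ∀ Z' ∈ C.lower, BadN Z' → ¬ Precedes μ Z' x.2 := fun Z' hZ' hb => nopred (false, Z') ((memB _).2 (Or.inl ⟨rfl, hZ', hb⟩))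
    have hPo : ∀ P' ∈ C.upper, BadP P' → ¬ Precedes μ P' x.2 := fun P' hP' hb => nopred (true, P') ((memB _).2 (Or.inr ⟨rfl, hP', hb⟩))
    rcases (memB x).1 hxB with ⟨-, hX, hb⟩ | ⟨-, hX, hb⟩
    · exact hN x.2 hb C hU hG hS hNo hPo hX
    · exact hP x.2 hb C hU hG hS hNo hPo hX
  · rw [Finset.not_nonempty_iff_eq_empty] at hB
    refine ⟨fun Z hZ hb => ?_, fun P hPu hb => ?_⟩
    · have : (false, Z) ∈ B := (memB _).2 (Or.inl ⟨rfl, hZ, hb⟩)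
      rw [hB] at this; simp at this
    · have : (true, P) ∈ B := (memB _).2 (Or.inr ⟨rfl, hPu, hb⟩)
      rw [hB] at this; simp at this

/-- **THE CEILING-FORK FAMILY HAS ITS SPAN STEP WITH AN EMPTY INDUCTION HYPOTHESIS** (KERNEL, every `h`, every bad family, every tie-break):
the first law-free rung of the span induction on the ceiling side. -/
theorem spanStepN_ceilingForkFamily (h : ℤ) (μ : MCell → ℤ) (BadN BadP : MCell → Prop) {Z : MCell} {φ ψ χ : Fin 4} (hφψ : φ ≠ ψ)
    (h0 : Z 0 = floorUnit φ) (h1 : Z 1 = floorUnit ψ) (h2 : Z 2 = ceilingUnit h χ) (h3 : Z 3 = (h, 0, 0)) :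
    SpanStepN h μ BadN BadP Z := fun _ hU hG hS _ _ =>
  ceilingForkFamily_absent_static hU hG hS hφψ h0 h1 h2 h3

/-- the ceiling-fork cells are FULL-SPAN (`span = h`, for `h ≥ 2`): they sit at the top of the kill order. -/
theorem span_ceilingForkFamily {h : ℤ} (hh : 2 ≤ h) {Z : MCell} {φ ψ χ : Fin 4}
    (h0 : Z 0 = floorUnit φ) (h1 : Z 1 = floorUnit ψ) (h2 : Z 2 = ceilingUnit h χ) (h3 : Z 3 = (h, 0, 0)) : span Z = h := by
  have e0 : causalTop (Z 0) = 2 ∧ nodeLevel (Z 0) = 0 := by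
    rw [h0]; fin_cases φ <;> simp [ray, causalTop, nodeLevel, absCharge, chargeOf]
  have e1 : causalTop (Z 1) = 2 ∧ nodeLevel (Z 1) = 0 := by
    rw [h1]; fin_cases ψ <;> simp [ray, causalTop, nodeLevel, absCharge, chargeOf]
  have e2 : causalTop (Z 2) = h ∧ nodeLevel (Z 2) = h - 2 := by
    rw [h2]; fin_cases χ <;> simp [ray, causalTop, nodeLevel, absCharge, chargeOf] <;> omega
  have e3 : causalTop (Z 3) = h ∧ nodeLevel (Z 3) = h := by
    rw [h3]; simp [causalTop, nodeLevel, absCharge, chargeOf]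
  simp only [span, cellTop, cellNode, e0.1, e0.2, e1.1, e1.2, e2.1, e2.2, e3.1, e3.2]
  omega

/-! ## §7 THE TWIN-FORK FAMILY `P{c·ℓ_φ, 2I + ((h−4)/2)·ℓ_u, hI, hI}` IS ABSENT (law-free, every even `h ≥ 6`; RULE D + X⁺ only, no G₁) -/

/-- the floor letter `c·ℓ_φ` (node `0`, top `2c`). -/
abbrev floorLetter (φ : Fin 4) (c : ℤ) : BPoint := ray ((0, 0, 0) : BPoint) φ c

/-- the letter `2I + n·ℓ_u` (node `2`, top `2 + 2n`). -/
abbrev nodeTwoLetter (u : Fin 4) (n : ℤ) : BPoint := ray ((2, 0, 0) : BPoint) u n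

theorem floorLetter_not_isApex (φ : Fin 4) {c : ℤ} (hc : c ≠ 0) : ¬ isApex (floorLetter φ c) := by
  fin_cases φ <;> simp [ray, isApex, hc]

theorem nodeTwoLetter_not_isApex (u : Fin 4) {n : ℤ} (hn : n ≠ 0) : ¬ isApex (nodeTwoLetter u n) := by
  fin_cases u <;> simp [ray, isApex, hn]

/-- node direction `φ + 2` of `c·ℓ_φ`, coordinate `0`. -/
theorem floorLetter_node (φ : Fin 4) (c : ℤ) : Adapted (floorLetter φ c) (φ + 2) ∧ coord (floorLetter φ c) (φ + 2) = 0 :=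
  ⟨(adapted_ray_apex 0 φ c).2, coord_ray_apex_antip 0 φ c⟩

/-- node direction `u + 2` of `2I + n·ℓ_u`, coordinate `2`. -/
theorem nodeTwoLetter_node (u : Fin 4) (n : ℤ) : Adapted (nodeTwoLetter u n) (u + 2) ∧ coord (nodeTwoLetter u n) (u + 2) = 2 :=
  ⟨(adapted_ray_apex 2 u n).2, coord_ray_apex_antip 2 u n⟩

/-- top direction `u` of `2I + n·ℓ_u`, coordinate `2 + 2n`. -/
theorem nodeTwoLetter_top (u : Fin 4) (n : ℤ) : Adapted (nodeTwoLetter u n) u ∧ coord (nodeTwoLetter u n) u = 2 + 2 * n := by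
  refine ⟨(adapted_ray_apex 2 u n).1, ?_⟩
  rw [coord_ray_self, coord_of_isApex ⟨rfl, rfl⟩]

theorem nodeTwoLetter_fst (u : Fin 4) (n : ℤ) : (nodeTwoLetter u n).1 = 2 + n := by
  fin_cases u <;> simp [ray]

theorem floorLetter_fst (φ : Fin 4) (c : ℤ) : (floorLetter φ c).1 = c := by
  fin_cases φ <;> simp [ray]

/-- `2I + n·ℓ_u` read from the ceiling apex: `= (2n+4)I − n'`… precisely `ray (2 + 2n + 2·0, …)`: `2I + n ℓ_u = ray ((2+2n)I) (u+2) (−n)`. -/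
theorem nodeTwoLetter_flip (u : Fin 4) (n : ℤ) : nodeTwoLetter u n = ray ((2 + 2 * n, 0, 0) : BPoint) (u + 2) (-n) :=
  ray_apex_flip 2 n u

theorem floorLetter_flip (φ : Fin 4) (c : ℤ) : floorLetter φ c = ray ((2 * c, 0, 0) : BPoint) (φ + 2) (-c) := by
  have := ray_apex_flip 0 c φ; simpa using this

/-- **ABOVE `2I + m·ℓ_u` ALONG `u` THERE IS ONE STEP** in ◇_{2m+4}: `ray (2I + m ℓ_u) u e ∈ ◇_h`, `e > 0` ⇒ `e = 1`. -/
theorem above_nodeTwoLetter {h m e : ℤ} {z : BPoint} {u : Fin 4} (hh : h = 2 * m + 4) (hm : 0 ≤ m) (he : 0 < e)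
    (hz : InDiamond h z) (hze : z = ray (nodeTwoLetter u m) u e) : e = 1 := by
  have htop := hz.2.2.2
  rw [hze, show ray (nodeTwoLetter u m) u e = ray ((2, 0, 0) : BPoint) u (m + e) from (ray_add _ u m e).symm,
    top_ray_apex 2 u (by omega)] at htop
  omega

/-- **BELOW A FLOOR-NODE LETTER ONLY ITS OWN RAY**: a point of ◇_h strictly null-below `c·ℓ_φ` (`c ≥ 0`; `c = 0` is the origin `O`, below which
there is nothing) in direction `r` has `r = φ`. -/
theorem below_floorLetter {h c d : ℤ} {z : BPoint} (hz : InDiamond h z) {φ r : Fin 4} (hc : 0 ≤ c) (hd : 0 < d)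
    (he : floorLetter φ c = ray z r d) : r = φ := by
  obtain ⟨α, a, b⟩ := z
  obtain ⟨hax, h1, -, -⟩ := hz
  simp only [AxisPt, absCharge, chargeOf, ray, Prod.mk.injEq] at hax h1 he
  fin_cases φ <;> fin_cases r <;> simp at hax h1 he ⊢ <;>
    (simp only [abs_eq_max_neg, max_def] at h1; split_ifs at h1 <;> omega)

/-- **BELOW THE CEILING LETTER `2I + (m+1)ℓ_u` OFF ITS OWN RAY THERE IS ONLY THE FULL LETTER `(m+2)ℓ_u`** (in ◇_{2m+4}): a point `z ∈ ◇_h` with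
`2I + (m+1)ℓ_u = ray z r d`, `d > 0`, `r ≠ u` has `r = u + 2`, `d = 1`, `z = (m+2)·ℓ_u`. -/
theorem below_nodeTwoTop {h m d : ℤ} {z : BPoint} {u r : Fin 4} (hh : h = 2 * m + 4) (hm : 0 ≤ m) (hz : InDiamond h z) (hd : 0 < d)
    (hr : r ≠ u) (he : nodeTwoLetter u (m + 1) = ray z r d) : r = u + 2 ∧ d = 1 ∧ z = floorLetter u (m + 2) := by
  obtain ⟨α, a, b⟩ := z
  obtain ⟨hax, h1, -, h3⟩ := hz
  simp only [AxisPt, absCharge, chargeOf, ray, Prod.mk.injEq] at hax h1 h3 he ⊢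
  fin_cases u <;> fin_cases r <;> simp at hax h1 h3 he hr ⊢ <;>
    (simp only [abs_eq_max_neg, max_def] at h1 h3; split_ifs at h1 h3 <;> omega)

theorem onCeiling_fullLetter {h m : ℤ} (hh : h = 2 * m + 4) (hm : 0 ≤ m) (u : Fin 4) : OnCeiling h (floorLetter u (m + 2)) := by
  show (ray ((0, 0, 0) : BPoint) u (m + 2)).1 + absCharge (ray ((0, 0, 0) : BPoint) u (m + 2)) = h
  rw [top_ray_apex 0 u (by omega)]; omega

/-- **THE TWIN LIFT** (KERNEL; RULE D at the `P`-cell): `P = P{x, 2I + m ℓ_u, hI, …}` (slots 0,1,2; `h = 2m+4`, `m ≥ 1`) has the `N`-parent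
`P(1 ↦ 2I + (m+1)ℓ_u)` present as a `u`-partner. -/
theorem twin_lift {h m : ℤ} {C : MConfig} (hU : C.InDiamond h) (hh : h = 2 * m + 4) (hm : 1 ≤ m) {P : MCell} (hP : P ∈ C.upper)
    (hD : RuleDMu4P C P) {u : Fin 4} (h1 : P 1 = nodeTwoLetter u m) (h2 : P 2 = (h, 0, 0)) :
    ∃ N ∈ C.lower, UPartner N P 1 u ∧ N 1 = nodeTwoLetter u (m + 1) := by
  have hna : ¬ isApex (P 1) := by rw [h1]; exact nodeTwoLetter_not_isApex u (by omega)
  have hk : Adapted (P 1) u := by rw [h1]; exact (nodeTwoLetter_top u m).1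
  have hkh : coord (P 1) u ≠ h := by rw [h1, (nodeTwoLetter_top u m).2]; omega
  obtain ⟨N, hN, hNP⟩ := upLine_of_ruleDMu4P hU hP hD (g := 2) (j := 1) (by decide) (by rw [h2]; exact onCeiling_apex h) hna hk hkh
  have he0 : 0 < (N 1).1 - (P 1).1 := by have := hNP.2.1; omega
  have e : N 1 = ray (nodeTwoLetter u m) u ((N 1).1 - (P 1).1) := by rw [← h1]; exact hNP.2.2
  have he1 := above_nodeTwoLetter hh (by omega) he0 (hU.1 N hN 1) e
  refine ⟨N, hN, hNP, ?_⟩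
  rw [e, he1]; exact (ray_add _ u m 1).symm

/-- **THE TWIN DESCENT** (KERNEL; RULE D at the `N`-cell): `N = N{c·ℓ_φ, 2I + (m+1)ℓ_u, …}` (slots 0,1; `c ≥ 1`, `h = 2m+4`) has the `P`-child
`N(1 ↦ (m+2)ℓ_u)` present, as a `(u+2)`-partner.  (Pair: node of the floor letter `= 0` vs node of the ceiling letter `= 2`; the floor node is
neither settled nor covered below; the ceiling letter's node is settled below only off its own ray, i.e. by the full letter.) -/
theorem twin_descent {h m c : ℤ} {C : MConfig} (hU : C.InDiamond h) (hh : h = 2 * m + 4) (hm : 0 ≤ m) (hc : 0 ≤ c) {N : MCell}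
    (hD : RuleDMu4N C N) {φ u : Fin 4} (h0 : N 0 = floorLetter φ c) (h1 : N 1 = nodeTwoLetter u (m + 1)) :
    ∃ P' ∈ C.upper, UPartner N P' 1 (u + 2) ∧ P' 1 = floorLetter u (m + 2) := by
  have hk : Adapted (N 0) (φ + 2) := by rw [h0]; exact (floorLetter_node φ c).1
  have hk0 : coord (N 0) (φ + 2) = 0 := by rw [h0]; exact (floorLetter_node φ c).2
  have hk' : Adapted (N 1) (u + 2) := by rw [h1]; exact (nodeTwoLetter_node u (m + 1)).1
  have hk'2 : coord (N 1) (u + 2) = 2 := by rw [h1]; exact (nodeTwoLetter_node u (m + 1)).2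
  have hne : coord (N 0) (φ + 2) ≠ coord (N 1) (u + 2) := by rw [hk0, hk'2]; decide
  -- no service below the floor letter except along its own ray
  have nob : ∀ P ∈ C.upper, ∀ r : Fin 4, (P 0).1 < (N 0).1 → N 0 = ray (P 0) r ((N 0).1 - (P 0).1) → r = φ := fun P hP r hlt hray => by
    have e : floorLetter φ c = ray (P 0) r ((N 0).1 - (P 0).1) := by rw [← h0]; exact hray
    exact below_floorLetter (hU.2 P hP 0) hc (by omega) e
  rcases hD 0 1 (by decide) (φ + 2) (u + 2) hk hk' hne with ⟨r, hr, P, hP, hZP⟩ | ⟨r, hr, P, hP, hZP⟩ | ⟨a, a', ha, -, P, hP, -, hb1, hb2, -, -⟩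
  · -- `(0, φ+2)` settled below in a direction `r ≠ φ` — impossible
    exact absurd ((nob P hP r hZP.2.1 hZP.2.2).trans (fin4_add_two_add_two φ).symm) hr
  · -- `(1, u+2)` settled below in a direction `r ≠ u`: the server is the full letter, one step down the other ray
    have hd : 0 < (N 1).1 - (P 1).1 := by have := hZP.2.1; omega
    have e : nodeTwoLetter u (m + 1) = ray (P 1) r ((N 1).1 - (P 1).1) := by rw [← h1]; exact hZP.2.2
    have hr' : r ≠ u := fun e' => hr (by rw [e', fin4_add_two_add_two])
    obtain ⟨hr2, -, hz⟩ := below_nodeTwoTop hh hm (hU.2 P hP 1) hd hr' e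
    subst hr2
    exact ⟨P, hP, hZP, hz⟩
  · -- covered below: the cover moves the floor-node letter down in a direction `a` with `DirOK (N 0) (φ+2) a`, i.e. `a ≠ φ` — impossible
    have hφ := nob P hP a hb1 hb2
    rcases ha with e | ⟨-, hne2⟩
    · exact absurd (e.symm.trans hφ) (fin4_ne_add_two φ).symm
    · exact (hne2 (hφ.trans (fin4_add_two_add_two φ).symm)).elim

/-- **THE TWIN-FORK FAMILY** `P{x, 2I + m·ℓ_u, hI, w}` (slots 0,1,2, slot 3 ARBITRARY; `x = c·ℓ_φ` a floor-node letter, `c ≥ 0`, `c = 0` the origin;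
`h = 2m + 4`, `m ≥ 1`) **IS ABSENT from every two-level design in ◇_h obeying RULE D and the X⁺ law** (KERNEL, every such `h`; NO symmetry of the design,
no G₁, is used).  Census: the 604 orbits of ◇₈ `P`-cells ⊇ {node-0 letter, 2I+2ℓ_u, 8I} (j318002 h8 peel table a459e02921a60310) and the 1145 orbits of
◇₁₀ `P`-cells ⊇ {node-0 letter, 2I+3ℓ_u, 10I} (h10 table 74004db439790926) are ALL peel round 1 (598 + 1142 of kind `P:Xp`, 6 + 3 `P:DN`).  Certificate: the lift `N = P(1 ↦ 2I+(m+1)ℓ_u)` (`twin_lift`), the descent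
`P' = N(1 ↦ (m+2)ℓ_u)` (`twin_descent`), and the X⁺ fork at the ceiling letter `N 1` with the two distance-one children `P` (direction `u`) and `P'`
(direction `u+2`) (`xplus_fork`; lowest server and no-companion by distance one, (H-e′) by `ceiling_effective_sameRay` + `fork_effective`). -/
theorem twinForkFamily_absent {h m c : ℤ} {C : MConfig} (hU : C.InDiamond h) (hDN : ∀ Z ∈ C.lower, RuleDMu4N C Z)
    (hDP : ∀ P ∈ C.upper, RuleDMu4P C P) (hX : XPlusClosed C) (hh : h = 2 * m + 4) (hm : 1 ≤ m) (hc : 0 ≤ c)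
    {P : MCell} {φ u : Fin 4} (h0 : P 0 = floorLetter φ c) (h1 : P 1 = nodeTwoLetter u m) (h2 : P 2 = (h, 0, 0)) :
    P ∉ C.upper := fun hP => by
  -- the lift
  obtain ⟨N, hN, hNP, hN1⟩ := twin_lift hU hh hm hP (hDP P hP) h1 h2
  have hN0 : N 0 = floorLetter φ c := (hNP.1 0 (by decide)).symm.trans h0
  have hN2 : N 2 = (h, 0, 0) := (hNP.1 2 (by decide)).symm.trans h2
  -- the descent
  obtain ⟨P', hP', hNP', hP'1⟩ := twin_descent hU hh (by omega) hc (hDN N hN) hN0 hN1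
  -- the fork
  have hz : N 1 = ray ((h, 0, 0) : BPoint) (u + 2) (-(m + 1)) := by
    rw [hN1, nodeTwoLetter_flip]; congr 2; omega
  have hw : P' 1 = ray ((h, 0, 0) : BPoint) (u + 2) (-(m + 2)) := by
    rw [hP'1, floorLetter_flip]; congr 2; omega
  have hy : P 1 = ray (N 1) (u + 2 + 2) (-1) := by
    rw [fin4_add_two_add_two, hN1, h1, ← ray_add]; congr 1; omega
  refine xplus_fork hU hX hN (g := 1) (f := 2) (by decide) hN2 hP hP' (r₁ := u) (r₂ := u + 2) (fin4_ne_add_two u).symm hNP hNP'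
    (by rw [h1]; exact nodeTwoLetter_not_isApex u (by omega)) ?_ ?_ ?_
  · -- lowest server: every `u`-server of `P` at slot 1 sits at distance one
    intro X hX' hXP
    have he0 : 0 < (X 1).1 - (P 1).1 := by have := hXP.2.1; omega
    have e : X 1 = ray (nodeTwoLetter u m) u ((X 1).1 - (P 1).1) := by rw [← h1]; exact hXP.2.2
    have := above_nodeTwoLetter hh (by omega) he0 (hU.1 X hX' 1) e
    have hP1 : (P 1).1 = 2 + m := by rw [h1, nodeTwoLetter_fst]
    have hN1' : (N 1).1 = 2 + (m + 1) := by rw [hN1, nodeTwoLetter_fst]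
    omega
  · -- no companion strictly between distance-one points
    intro X _ _ hlt1 hlt2
    exfalso
    have hN1' : (N 1).1 = 2 + (m + 1) := by rw [hN1, nodeTwoLetter_fst]
    have hP'1' : (P' 1).1 = m + 2 := by rw [hP'1, floorLetter_fst]
    omega
  · -- (H-e′): a letter causally above the full letter `(m+2)ℓ_u` is on its ceiling line; not timelike-above `P 1` ⇒ causally below `N 1`
    intro X hX' _ _ hE hnT
    have hXc : OnCeiling h (X 1) :=
      onCeiling_of_effective_above (by rw [hP'1]; exact onCeiling_fullLetter hh (by omega) u) (hU.2 P' hP' 1).1 (hU.1 X hX' 1) hE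
    obtain ⟨d₂, -, -, hx⟩ := ceiling_effective_sameRay (by omega : (0 : ℤ) < m + 2) hw hXc (hU.1 X hX' 1).1 hE
    exact fork_effective one_pos hz hy hx hnT

/-- from the packaged laws. -/
theorem twinForkFamily_absent_static {h m c : ℤ} {C : MConfig} (hU : C.InDiamond h) (hS : C.StaticH1) (hh : h = 2 * m + 4) (hm : 1 ≤ m)
    (hc : 0 ≤ c) {P : MCell} {φ u : Fin 4} (h0 : P 0 = floorLetter φ c) (h1 : P 1 = nodeTwoLetter u m) (h2 : P 2 = (h, 0, 0)) :
    P ∉ C.upper :=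
  twinForkFamily_absent hU hS.1.1 hS.1.2 hS.2.1 hh hm hc h0 h1 h2

/-- the origin case `P{O, 2I + m·ℓ_u, hI, w}` (`c = 0`). -/
theorem twinForkFamily_absent_origin {h m : ℤ} {C : MConfig} (hU : C.InDiamond h) (hS : C.StaticH1) (hh : h = 2 * m + 4) (hm : 1 ≤ m)
    {P : MCell} {u : Fin 4} (h0 : P 0 = (0, 0, 0)) (h1 : P 1 = nodeTwoLetter u m) (h2 : P 2 = (h, 0, 0)) : P ∉ C.upper :=
  twinForkFamily_absent_static (c := 0) (φ := 0) hU hS hh hm le_rfl (by rw [h0]; simp [ray]) h1 h2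

/-- the j318002 representative `P[l-1|2I+2l-1|8I|8I]` (◇₈ peel table a459e02921a60310: twin-apex `P`-cell, round 1, kind `P:Xp`, 3 propagations). -/
def censusTwin8 : MCell := ![(1, -1, 0), (4, -2, 0), (8, 0, 0), (8, 0, 0)]

theorem censusTwin8_spec : censusTwin8 0 = floorLetter 2 1 ∧ censusTwin8 1 = nodeTwoLetter 2 2 ∧ censusTwin8 2 = (8, 0, 0) ∧ censusTwin8 3 = (8, 0, 0) := by
  refine ⟨?_, ?_, ?_, ?_⟩ <;> simp [censusTwin8, ray]

theorem censusTwin8_absent {C : MConfig} (hU : C.InDiamond 8) (hS : C.StaticH1) : censusTwin8 ∉ C.upper :=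
  twinForkFamily_absent_static (m := 2) (c := 1) hU hS (by norm_num) (by norm_num) zero_le_one
    censusTwin8_spec.1 censusTwin8_spec.2.1 censusTwin8_spec.2.2.1

/-- the shortest census certificate of the family: `P[O|O|2I+2l-1|8I]` (◇₈ round 1, `P:Xp`, 3 propagations; var 442), here in slot order `(O, 2I+2ℓ, 8I, O)`. -/
def censusTwin8o : MCell := ![(0, 0, 0), (4, -2, 0), (8, 0, 0), (0, 0, 0)]

theorem censusTwin8o_absent {C : MConfig} (hU : C.InDiamond 8) (hS : C.StaticH1) : censusTwin8o ∉ C.upper :=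
  twinForkFamily_absent_origin (m := 2) (u := 2) hU hS (by norm_num) (by norm_num) (by simp [censusTwin8o]) (by simp [censusTwin8o, ray])
    (by simp [censusTwin8o])


/-- **THE TWIN-FORK FAMILY HAS ITS SPAN STEP WITH AN EMPTY INDUCTION HYPOTHESIS** (KERNEL, every `h = 2m+4`, `m ≥ 1`, every bad family, every
tie-break): the first law-free rung of the span induction on the floor (`P`) side. -/
theorem spanStepP_twinForkFamily (h : ℤ) (μ : MCell → ℤ) (BadN BadP : MCell → Prop) {m c : ℤ} (hh : h = 2 * m + 4) (hm : 1 ≤ m) (hc : 0 ≤ c)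
    {P : MCell} {φ u : Fin 4} (h0 : P 0 = floorLetter φ c) (h1 : P 1 = nodeTwoLetter u m) (h2 : P 2 = (h, 0, 0)) :
    SpanStepP h μ BadN BadP P := fun _ hU _ hS _ _ =>
  twinForkFamily_absent_static hU hS hh hm hc h0 h1 h2


end Summit.HodgeConjecture.HodgeConjecture.Cruxes.BlochSeedDiscOne.CeilingFork
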